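import Summits.HodgeConjecture.FermatCycles.ConditionQFourfoldSearch
import Summits.HodgeConjecture.FermatCycles.ConditionQFourfoldSeventyEightTable
import Summits.HodgeConjecture.FermatCycles.ConditionQFourfoldSeventyEightA
import Summits.HodgeConjecture.FermatCycles.ConditionQFourfoldSeventyEightB
import Summits.HodgeConjecture.FermatCycles.ConditionQFourfoldSeventyEightC
import Summits.HodgeConjecture.FermatCycles.ConditionQFourfoldSeventyEightD
import Summits.HodgeConjecture.FermatCycles.ConditionQFourfoldSeventyEightE
import HarnessLib

/-!
# Shioda's stable-generation condition `(Q⁴ₘ)` at `m = 78` and the failure of `(P⁴ₘ)` — kernel certificate (part F of 6)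

HONEST FRAMING: explicit algebraic cycles for specific Hodge classes on Fermat/Delsarte varieties;
residual open instances listed; no claim on general Hodge.

Topic path `Summits/HodgeConjecture/FermatCycles/` of cell `pub-hfermat` (new work, not literature: a computer determination of the cell —
`pub-hfermat-enum/P4-TABLE.md` §(Q⁴ₘ), two implementations — certified by the Lean kernel). Framework: `ConditionQFourfold.lean`
(certificate Booleans, searches `checkQU`/`checkQN`) and `ConditionQFourfoldSearch.lean` (`conditionQ_four_of_normalized`).

THE STATEMENT. Shioda, Math. Ann. 245 (1979) §4 p. 183: `(Qⁿₘ)` — every element of `Mₘ(y)`, `3 ≤ y ≤ n/2 + 1`, is `ξ₁ − ξ₂` with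
`ξ₁, ξ₂ ∈ M'ₘ = ⟨Mₘ(1), Mₘ(2), Mₘ(3)^sd⟩` (pairs, Hodge classes of the Fermat surface, semi-decomposable sextuples); by his Claim
(p. 183, Lemmas 2–3) `(Qⁿₘ)` may replace `(Pⁿₘ)` in Theorem III (`⇒` the Hodge conjecture for `Xⁿₘ`); p. 184: "we do not know any
value of `m` which satisfies `(Qₘ)` but not `(Pₘ)`". Tree: `Literature.AlgebraicGeometry.Shioda1979.ConditionQ m n`, `MPrime`,
`forall_of_conditionQ` (the Claim's arithmetic spine), `ConditionP` (Math. Ann. form of `(P)`), `FermatCharacter.ShiodaConditionUpTo`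
(Proc. Japan Acad. form, with the semi-decomposable alternative).

WHAT IS PROVED HERE (level `m = 78`, part F).
* part F of 6: the kernel searches `checkQN 78 T 16 5`, `checkQN 78 T 21 57` (112878 tuples);
* **`conditionQ_seventyEight_four : Shioda1979.ConditionQ 78 4`** — `(Q⁴ₘ)` holds at `m = 78`: every Hodge sextuple over `ℤ/78` (every Hodge character of the
  Fermat fourfold `X⁴ₘ`, `m = 78`, up to permutation) is `ξ₁ − ξ₂`, `ξᵢ ∈ M'ₘ`;
* `forall_of_closed_cancellative_seventyEight`: by Shioda's Claim (`forall_of_conditionQ`), every Shioda-closed, Lemma-3-cancellative family of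
  multisets over `ℤ/78` contains every non-empty Hodge multiset of cardinality `≤ 6`;
* the NEGATIVE side on the sextuple `s = (1, 6, 12, 64, 75, 76)`: Hodge (`isHodgeMultiset_fail_seventyEight`), no proper non-empty sub-multiset with
  zero sum (`sum_ne_zero_of_mem_powerset_fail_seventyEight`: hence not decomposable, not semi-decomposable), not quasi-decomposable (`fail_seventyEight_key`,
  `78 · 2⁸` kernel cases) ⇒ **`not_shiodaConditionUpTo_seventyEight_four : ¬ ShiodaConditionUpTo 78 4`** (the Proc. Japan Acad. form of `(P⁴ₘ)`
  fails), `not_conditionP_seventyEight_four : ¬ Shioda1979.ConditionP 78 4` (the Math. Ann. form fails), and the conjunction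
  `conditionQ_not_conditionP_seventyEight : ConditionQ 78 4 ∧ ¬ ConditionP 78 4` — at `m = 78`, for fourfolds, Shioda's weakening `(Q)` of `(P)` is
  NECESSARY as well as sufficient.

NUMBERS (this seat's search `code/lit/q4/q4norm.py` = implementation 2; implementation 1 = ENUM `code/enum/q4table.py`,
`data/shioda_Q4_m3-100.json`): case U visits 151754 sorted tuples and case N 391422; 6617 of them are Hodge sextuples; all but 156 carry a
`(P)`-witness (case N pair 144, case N quasi 76, case N pair 4680, case N quasi 180, case N semi 50, case U pair 1176, case U quasi 137, case U semi 18); the other 156 — `(1, 6, 12, 64, 75, 76)` (case U); `(1, 6, 42, 45, 64, 76)` (case U); `(1, 7, 44, 49, 59, 74)` (case U); `(1, 7, 44, 53, 62, 67)` (case U); `(1, 7, 53, 54, 59, 60)` (case U); `(1, 9, 20, 56, 73, 75)` (case U); `(1, 9, 42, 49, 61, 72)` (case U); `(1, 10, 41, 53, 59, 70)` (case U); `(1, 10, 41, 56, 62, 64)` (case U); `(1, 10, 45, 53, 62, 63)` (case U); `(1, 11, 40, 54, 56, 72)` (case U); `(1, 12, 21, 60, 64, 76)` (case U); `(1, 12,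 28, 54, 64, 75)` (case U); `(1, 12, 32, 42, 71, 76)` (case U); `(1, 12, 32, 42, 73, 74)` (case U); `(1, 12, 42, 50, 53, 76)` (case U); `(1, 12, 42, 53, 54, 72)` (case U); `(1, 12, 43, 49, 54, 75)` (case U); `(1, 12, 43, 54, 55, 69)` (case U); `(1, 12, 43, 55, 60, 63)` (case U); `(1, 14, 40, 53, 54, 72)` (case U); `(1, 18, 30, 49, 61, 75)` (case U); `(1, 20, 21, 45, 73, 74)` (case U); `(1, 20, 31, 45, 63, 74)` (case U); `(1, 20, 31, 54, 56, 72)` (case U); `(1, 20, 41, 43, 62, 67)` (case U); `(1, 20, 43, 45, 62, 63)` (case U); `(1, 21, 30, 49, 61, 72)` (case U); `(1, 21, 44, 45, 49, 74)` (case U); `(1, 21, 44, 45, 53, 70)` (case U); `(1, 21, 45, 53, 54, 60)` (case U); `(1, 24, 27, 42, 64, 76)` (case U); `(1, 27, 28, 40, 66, 72)` (case U); `(1, 27, 28, 42, 64, 72)` (case U); `(1, 27, 31, 32, 69, 74)` (case U); `(1, 27, 42, 43, 49, 72)` (case U); `(1, 27, 43, 48, 55, 60)` (case U); `(1, 28,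 30, 40, 63, 72)` (case U); `(1, 28, 32, 44, 59, 70)` (case U); `(1, 28, 32, 54, 59, 60)` (case U); `(1, 28, 36, 40, 54, 75)` (case U); `(1, 28, 40, 45, 54, 66)` (case U); `(1, 28, 42, 45, 54, 64)` (case U); `(1, 30, 32, 42, 56, 73)` (case U); `(1, 30, 41, 42, 53, 67)` (case U); `(1, 30, 41, 42, 56, 64)` (case U); `(1, 30, 42, 45, 53, 63)` (case U); `(1, 31, 32, 54, 56, 60)` (case U); `(1, 39, 42, 45, 53, 54)` (case U); `(1, 42, 43, 45, 49, 54)` (case U); `(2, 3, 14, 66, 72, 77)` (case N); `(2, 9, 28, 57, 63, 75)` (case N); `(2, 14, 18, 57, 66, 77)` (case N); `(2, 14, 33, 36, 72, 77)` (case N); `(2, 14, 36, 51, 54, 77)` (case N); `(2, 22, 28, 45, 63, 74)` (case N); `(2, 27, 28, 36, 66, 75)` (case N); `(2, 27, 28, 38, 64, 75)` (case N); `(2, 27, 28, 45, 66, 66)` (case N); `(2, 28, 30, 36, 63, 75)` (case N); `(2, 28, 30, 45, 63, 66)` (case N); `(3, 10, 18, 62, 69, 72)` (case N); `(3, 10,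 24, 62, 63, 72)` (case N); `(3, 10, 32, 58, 62, 69)` (case N); `(3, 10, 45, 51, 62, 63)` (case N); `(3, 12, 42, 50, 51, 76)` (case N); `(3, 14, 24, 50, 66, 77)` (case N); `(3, 14, 33, 40, 72, 72)` (case N); `(3, 14, 40, 50, 51, 76)` (case N); `(3, 14, 40, 51, 54, 72)` (case N); `(3, 15, 21, 50, 69, 76)` (case N); `(3, 15, 42, 48, 50, 76)` (case N); `(3, 21, 22, 45, 69, 74)` (case N); `(3, 21, 44, 45, 51, 70)` (case N); `(3, 24, 38, 42, 50, 77)` (case N); `(3, 30, 32, 42, 58, 69)` (case N); `(3, 32, 42, 42, 57, 58)` (case N); `(4, 9, 28, 60, 66, 67)` (case N); `(4, 9, 33, 56, 57, 75)` (case N); `(4, 9, 33, 56, 60, 72)` (case N); `(4, 9, 44, 51, 56, 70)` (case N); `(4, 9, 51, 54, 56, 60)` (case N); `(4, 15, 28, 54, 66, 67)` (case N); `(4, 15, 33, 50, 56, 76)` (case N); `(4, 15, 33, 54, 56, 72)` (case N); `(4, 15, 51, 54, 54, 56)` (case N); `(4, 28, 30, 51, 54, 67)` (case N); `(4, 30,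 34, 51, 54, 61)` (case N); `(6, 6, 38, 45, 64, 75)` (case N); `(6, 9, 16, 60, 68, 75)` (case N); `(6, 12, 38, 50, 51, 77)` (case N); `(6, 14, 36, 50, 51, 77)` (case N); `(6, 15, 16, 54, 68, 75)` (case N); `(6, 15, 38, 48, 50, 77)` (case N); `(6, 18, 22, 45, 69, 74)` (case N); `(6, 21, 38, 45, 60, 64)` (case N); `(6, 22, 24, 45, 63, 74)` (case N); `(6, 24, 27, 38, 64, 75)` (case N); `(6, 32, 38, 42, 45, 71)` (case N); `(6, 32, 38, 42, 57, 59)` (case N); `(6, 38, 42, 45, 50, 53)` (case N); `(8, 10, 34, 57, 62, 63)` (case N); `(8, 22, 27, 34, 69, 74)` (case N); `(8, 27, 30, 34, 66, 69)` (case N); `(8, 27, 33, 34, 57, 75)` (case N); `(8, 27, 34, 42, 57, 66)` (case N); `(8, 30, 30, 34, 63, 69)` (case N); `(8, 30, 34, 42, 57, 63)` (case N); `(9, 10, 24, 48, 70, 73)` (case N); `(9, 12, 44, 48, 51, 70)` (case N); `(9, 14, 40, 51, 57, 63)` (case N); `(9, 15, 44, 48, 48, 70)` (case N); `(9, 16,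 20, 46, 68, 75)` (case N); `(9, 16, 21, 60, 60, 68)` (case N); `(9, 16, 24, 42, 70, 73)` (case N); `(9, 16, 34, 42, 60, 73)` (case N); `(9, 20, 36, 46, 48, 75)` (case N); `(9, 20, 45, 46, 48, 66)` (case N); `(9, 20, 45, 46, 51, 63)` (case N); `(10, 12, 18, 51, 70, 73)` (case N); `(10, 15, 18, 48, 70, 73)` (case N); `(10, 18, 18, 57, 62, 69)` (case N); `(10, 18, 24, 57, 62, 63)` (case N); `(10, 21, 24, 36, 70, 73)` (case N); `(12, 12, 33, 50, 51, 76)` (case N); `(12, 15, 33, 48, 50, 76)` (case N); `(12, 21, 32, 38, 60, 71)` (case N); `(12, 21, 36, 44, 51, 70)` (case N); `(12, 24, 33, 38, 50, 77)` (case N); `(12, 30, 32, 33, 58, 69)` (case N); `(12, 32, 33, 42, 57, 58)` (case N); `(14, 18, 20, 45, 66, 71)` (case N); `(14, 18, 33, 40, 57, 72)` (case N); `(14, 18, 40, 51, 54, 57)` (case N); `(14, 20, 36, 51, 54, 59)` (case N); `(14, 24, 33, 36, 50, 77)` (case N); `(14, 32, 33, 40, 57, 58)` (case N); `(15, 16,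 18, 42, 70, 73)` (case N); `(15, 16, 21, 44, 68, 70)` (case N); `(15, 16, 21, 54, 60, 68)` (case N); `(15, 16, 27, 33, 68, 75)` (case N); `(15, 16, 34, 42, 54, 73)` (case N); `(15, 21, 27, 38, 64, 69)` (case N); `(15, 21, 36, 44, 48, 70)` (case N); `(15, 27, 32, 33, 58, 69)` (case N); `(16, 21, 24, 30, 70, 73)` (case N); `(16, 21, 30, 34, 60, 73)` (case N); `(18, 20, 38, 42, 45, 71)` (case N); `(18, 22, 24, 27, 69, 74)` (case N); `(20, 21, 36, 36, 46, 75)` (case N); `(20, 21, 36, 45, 46, 66)` (case N); `(20, 21, 38, 45, 46, 64)` (case N); `(21, 24, 27, 38, 60, 64)` (case N); `(22, 24, 24, 27, 63, 74)` (case N); `(24, 27, 32, 38, 42, 71)` (case N); `(24, 27, 38, 42, 50, 53)` (case N) — carry the table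
certificate(s) written out in the statements below (generators checked by `genB`, the identity `s + ΣX = ΣY` by `decide`, all inside the kernel search).

PRINT STATUS (lit seat, 2026-08-20). `78 = 2·3·13`: NO refereed theorem gives the Hodge conjecture for `X⁴₇₈` (as for `66`; `3 | 78`). In the tree the sibling cell reaches `78` by level raising from `39`; the cell's table settles `(78, 4)` by Lemma 3 cancellation (E3). This file: `(Q⁴₇₈)` as a kernel theorem ⇒ HC(X⁴₇₈) from Shioda's printed Claim alone.

References: [Shioda1979HodgeFermat] T. Shioda, Math. Ann. 245 (1979) 175–184, §3 p. 180 (`(Pⁿₘ)`), §4 pp. 183–184 (`M'ₘ`, `(Qⁿₘ)`, Claim,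
the question); [Shioda1979PJA] T. Shioda, Proc. Japan Acad. 55A (1979) §1 (Definition (i)–(iii), `(Pⁿₘ)'`); [daSilva2021HodgeFermat]
G. da Silva Jr., Experimental Results 2 (2021) e22, Def. 2.4, Question 1; [Aoki2000FermatTypeRemarks] N. Aoki, Comment. Math. Univ.
St. Pauli 49 (2000), Thm 0.1. Cell: `pub-hfermat-enum/P4-TABLE.md`, `data/shioda_Q4_m3-100.json`, `code/lit/q4/` (this seat).
-/

namespace Summit.HodgeConjecture.FermatCycles.ConditionQFourfold

open Multiset
open Literature.AlgebraicGeometry.HodgeTheory Literature.AlgebraicGeometry.HodgeTheory.FermatCharacter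
open Literature.AlgebraicGeometry.Shioda1982 Literature.AlgebraicGeometry.Shioda1979
open Summit.HodgeConjecture.FermatCycles.ShiodaConditionFourfold

/-! ### Level `78` — part F -/

/-! The certificate table at level `78` is the definition `table78` of `ConditionQFourfoldSeventyEightTable.lean` (156 entries `(key, X, Y)`,
`s + ΣX = ΣY`; found by `code/lit/q4/q4norm.py`, every entry checked by the kernel inside the searches). -/

set_option maxHeartbeats 0 in
/-- The `(Q)`-search at level `78`, case N, first free representative in `[16, 21)` (61742 tuples). Kernel.
[cite: Shioda1979HodgeFermat, §4 condition (Qⁿₘ), p. 183] -/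
theorem checkQN_78_16 :
    checkQN 78
      table78
      16 5 = true := by
  decide +kernel

set_option maxHeartbeats 0 in
/-- The `(Q)`-search at level `78`, case N, first free representative in `[21, 78)` (51136 tuples). Kernel.
[cite: Shioda1979HodgeFermat, §4 condition (Qⁿₘ), p. 183] -/
theorem checkQN_78_21 :
    checkQN 78
      table78
      21 57 = true := by
  decide +kernel

/-- **`(Q⁴ₘ)` holds at `m = 78`**: every Hodge sextuple over `ℤ/78` is `ξ₁ − ξ₂` with `ξ₁, ξ₂ ∈ M'ₘ` (stably generated by pairs, Hodge
`4`-sets and semi-decomposable sextuples). Kernel certificate of the cell's entry `78 ∈ Q4_true_P4_false` (P4-TABLE §(Q⁴ₘ)).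
[cite: Shioda1979HodgeFermat, §4 condition (Qⁿₘ), p. 183] -/
theorem conditionQ_seventyEight_four : ConditionQ 78 4 :=
  haveI : Fact (1 < 78) := ⟨by norm_num⟩
  conditionQ_four_of_normalized 78
    table78
    [(1, 15), (16, 15), (31, 47)]
    (by
      intro b h0 hN
      rcases Nat.lt_or_ge b 16 with h0 | h0
      · exact ⟨(1, 15), by simp, by omega, by omega⟩
      rcases Nat.lt_or_ge b 31 with h1 | h1
      · exact ⟨(16, 15), by simp, by omega, by omega⟩
      exact ⟨(31, 47), by simp, by omega, by omega⟩)
    (by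
      intro p hp
      simp only [List.mem_cons, List.not_mem_nil, or_false] at hp
      rcases hp with rfl | rfl | rfl
      · exact checkQU_78_1
      · exact checkQU_78_16
      · exact checkQU_78_31)
    [(1, 2), (3, 1), (4, 2), (6, 2), (8, 1), (9, 1), (10, 2), (12, 2), (14, 2), (16, 5), (21, 57)]
    (by
      intro a h0 hN
      rcases Nat.lt_or_ge a 3 with h0 | h0
      · exact ⟨(1, 2), by simp, by omega, by omega⟩
      rcases Nat.lt_or_ge a 4 with h1 | h1
      · exact ⟨(3, 1), by simp, by omega, by omega⟩
      rcases Nat.lt_or_ge a 6 with h2 | h2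
      · exact ⟨(4, 2), by simp, by omega, by omega⟩
      rcases Nat.lt_or_ge a 8 with h3 | h3
      · exact ⟨(6, 2), by simp, by omega, by omega⟩
      rcases Nat.lt_or_ge a 9 with h4 | h4
      · exact ⟨(8, 1), by simp, by omega, by omega⟩
      rcases Nat.lt_or_ge a 10 with h5 | h5
      · exact ⟨(9, 1), by simp, by omega, by omega⟩
      rcases Nat.lt_or_ge a 12 with h6 | h6
      · exact ⟨(10, 2), by simp, by omega, by omega⟩
      rcases Nat.lt_or_ge a 14 with h7 | h7
      · exact ⟨(12, 2), by simp, by omega, by omega⟩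
      rcases Nat.lt_or_ge a 16 with h8 | h8
      · exact ⟨(14, 2), by simp, by omega, by omega⟩
      rcases Nat.lt_or_ge a 21 with h9 | h9
      · exact ⟨(16, 5), by simp, by omega, by omega⟩
      exact ⟨(21, 57), by simp, by omega, by omega⟩)
    (by
      intro p hp
      simp only [List.mem_cons, List.not_mem_nil, or_false] at hp
      rcases hp with rfl | rfl | rfl | rfl | rfl | rfl | rfl | rfl | rfl | rfl | rfl
      · exact checkQN_78_1
      · exact checkQN_78_3
      · exact checkQN_78_4
      · exact checkQN_78_6
      · exact checkQN_78_8
      · exact checkQN_78_9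
      · exact checkQN_78_10
      · exact checkQN_78_12
      · exact checkQN_78_14
      · exact checkQN_78_16
      · exact checkQN_78_21)

/-- **Shioda's Claim at `m = 78`**: every family of multisets over `ℤ/78` closed under the inductive structure of Fermat varieties
(pairs, surface classes, semi / star / hash) and under Lemma 3's cancellation contains every non-empty Hodge multiset with at most `6`
elements — the arithmetic form of "`(Q⁴ₘ)` ⇒ the Hodge conjecture for `X⁴ₘ`" at `m = 78` (geometric inputs = the hypotheses, as printed).
[cite: Shioda1979HodgeFermat, §4 Claim, Lemmas 2–3, p. 183] -/
theorem forall_of_closed_cancellative_seventyEight {C : Multiset (ZMod 78) → Prop} (hC : IsShiodaClosed C) (hL : IsCancellative C) :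
    ∀ s : Multiset (ZMod 78), s ≠ 0 → IsHodgeMultiset s → card s ≤ 6 → C s :=
  forall_of_conditionQ hC hL conditionQ_seventyEight_four

/-! ### The negative side at `m = 78`: `(P⁴ₘ)` fails on `s = (1, 6, 12, 64, 75, 76)` -/

/-- `s` is a Hodge sextuple over `ℤ/78` (a Hodge character of the Fermat fourfold of degree `78`). [cite: Shioda1979PJA, §1 eqs. (2)–(3)] -/
theorem isHodgeMultiset_fail_seventyEight : IsHodgeMultiset ({1, 6, 12, 64, 75, 76} : Multiset (ZMod 78)) :=
  isHodgeMultiset_of_hodgeUB (N := 78) (by decide +kernel)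

/-- Every proper non-empty sub-multiset of `s` has non-zero sum: `s` contains no pair `{a, −a}`, no Hodge sub-multiset, no zero-sum
triple. [cite: Shioda1979PJA, §1 Definition (i), (iii)] -/
theorem sum_ne_zero_of_mem_powerset_fail_seventyEight :
    ∀ t ∈ Multiset.powerset ({1, 6, 12, 64, 75, 76} : Multiset (ZMod 78)), t ≠ 0 → ({1, 6, 12, 64, 75, 76} : Multiset (ZMod 78)) - t ≠ 0 → t.sum ≠ 0 := by
  decide +kernel

/-- `s` is **not decomposable** (a summand would be a proper non-empty zero-sum sub-multiset). [cite: Shioda1979PJA, §1 Definition (i)] -/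
theorem not_isDecomposable_fail_seventyEight : ¬ IsDecomposable ({1, 6, 12, 64, 75, 76} : Multiset (ZMod 78)) := by
  rintro ⟨t, u, ht0, hu0, ht, -, heq⟩
  have htle : t ≤ ({1, 6, 12, 64, 75, 76} : Multiset (ZMod 78)) := heq ▸ Multiset.le_add_right t u
  have hu : ({1, 6, 12, 64, 75, 76} : Multiset (ZMod 78)) - t = u := by rw [heq, add_tsub_cancel_left]
  exact sum_ne_zero_of_mem_powerset_fail_seventyEight t (Multiset.mem_powerset.2 htle) ht0 (hu ▸ hu0) ht.1.2

/-- `s` is **not semi-decomposable** (no zero-sum triple). [cite: Shioda1979PJA, §1 Definition (iii)] -/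
theorem not_isSemiDecomposable_fail_seventyEight : ¬ IsSemiDecomposable ({1, 6, 12, 64, 75, 76} : Multiset (ZMod 78)) := by
  rintro ⟨t, u, ht3, hu3, hts, -, heq⟩
  have htle : t ≤ ({1, 6, 12, 64, 75, 76} : Multiset (ZMod 78)) := heq ▸ Multiset.le_add_right t u
  have hu : ({1, 6, 12, 64, 75, 76} : Multiset (ZMod 78)) - t = u := by rw [heq, add_tsub_cancel_left]
  have ht0 : t ≠ 0 := by rintro rfl; simp at ht3
  have hu0 : u ≠ 0 := by rintro rfl; simp at hu3
  exact sum_ne_zero_of_mem_powerset_fail_seventyEight t (Multiset.mem_powerset.2 htle) ht0 (hu ▸ hu0) hts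

/-- A Hodge multiset over `ℤ/78` satisfies the finitely many conditions used by the kernel refutation below (entries non-zero, sum
zero, Shioda's norm equation at the units `1, 7, 11, 17, 23, 29` — a sub-family of Shioda's equations (2) that already admits no splitting, chosen by
`code/lit/q4/minunits.py`). [cite: Shioda1979PJA, §1 eq. (2)] -/
theorem hodgeConditions_seventyEight {v : Multiset (ZMod 78)} (hv : IsHodgeMultiset v) :
    ((v).sum = 0 ∧ (∀ a ∈ v, a ≠ 0) ∧
            2 * mNormSum ((v).map fun a ↦ (1 : ZMod 78) * a) = 78 * Multiset.card (v) ∧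
            2 * mNormSum ((v).map fun a ↦ (7 : ZMod 78) * a) = 78 * Multiset.card (v) ∧
            2 * mNormSum ((v).map fun a ↦ (11 : ZMod 78) * a) = 78 * Multiset.card (v) ∧
            2 * mNormSum ((v).map fun a ↦ (17 : ZMod 78) * a) = 78 * Multiset.card (v) ∧
            2 * mNormSum ((v).map fun a ↦ (23 : ZMod 78) * a) = 78 * Multiset.card (v) ∧
            2 * mNormSum ((v).map fun a ↦ (29 : ZMod 78) * a) = 78 * Multiset.card (v)) := by
  have h1 := hv.2 (Units.mkOfMulEqOne 1 1 (by decide))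
  have h7 := hv.2 (Units.mkOfMulEqOne 7 67 (by decide))
  have h11 := hv.2 (Units.mkOfMulEqOne 11 71 (by decide))
  have h17 := hv.2 (Units.mkOfMulEqOne 17 23 (by decide))
  have h23 := hv.2 (Units.mkOfMulEqOne 23 17 (by decide))
  have h29 := hv.2 (Units.mkOfMulEqOne 29 35 (by decide))
  simp only [Units.val_mkOfMulEqOne] at h1 h7 h11 h17 h23 h29
  exact ⟨hv.1.2, hv.1.1, h1, h7, h11, h17, h23, h29⟩

set_option maxHeartbeats 0 in
/-- The arithmetic heart of "`s` is **not quasi-decomposable**": for every `e ∈ ℤ/78` and every splitting `s + {e, −e} = t + u` into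
non-empty parts different from `s`, one of `t`, `u` violates a condition of `hodgeConditions_seventyEight` (the zero-sum test comes first, so
the kernel discards almost every splitting on one addition). Kernel, one residue `e` at a time (`78 · 2⁸` cases). [cite: daSilva2021HodgeFermat, Def. 2.4] [cite: Shioda1979PJA, §1 Definition (ii)] -/
theorem fail_seventyEight_key :
    ∀ e : ZMod 78, ∀ t ∈ Multiset.powerset (({1, 6, 12, 64, 75, 76} : Multiset (ZMod 78)) + {e, -e}),
      ¬ (((t).sum = 0 ∧ (∀ a ∈ t, a ≠ 0) ∧
            2 * mNormSum ((t).map fun a ↦ (1 : ZMod 78) * a) = 78 * Multiset.card (t) ∧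
            2 * mNormSum ((t).map fun a ↦ (7 : ZMod 78) * a) = 78 * Multiset.card (t) ∧
            2 * mNormSum ((t).map fun a ↦ (11 : ZMod 78) * a) = 78 * Multiset.card (t) ∧
            2 * mNormSum ((t).map fun a ↦ (17 : ZMod 78) * a) = 78 * Multiset.card (t) ∧
            2 * mNormSum ((t).map fun a ↦ (23 : ZMod 78) * a) = 78 * Multiset.card (t) ∧
            2 * mNormSum ((t).map fun a ↦ (29 : ZMod 78) * a) = 78 * Multiset.card (t)) ∧
          (((({1, 6, 12, 64, 75, 76} : Multiset (ZMod 78)) + {e, -e}) - t).sum = 0 ∧ (∀ a ∈ (({1, 6, 12, 64, 75, 76} : Multiset (ZMod 78)) + {e, -e}) - t, a ≠ 0) ∧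
            2 * mNormSum (((({1, 6, 12, 64, 75, 76} : Multiset (ZMod 78)) + {e, -e}) - t).map fun a ↦ (1 : ZMod 78) * a) = 78 * Multiset.card ((({1, 6, 12, 64, 75, 76} : Multiset (ZMod 78)) + {e, -e}) - t) ∧
            2 * mNormSum (((({1, 6, 12, 64, 75, 76} : Multiset (ZMod 78)) + {e, -e}) - t).map fun a ↦ (7 : ZMod 78) * a) = 78 * Multiset.card ((({1, 6, 12, 64, 75, 76} : Multiset (ZMod 78)) + {e, -e}) - t) ∧
            2 * mNormSum (((({1, 6, 12, 64, 75, 76} : Multiset (ZMod 78)) + {e, -e}) - t).map fun a ↦ (11 : ZMod 78) * a) = 78 * Multiset.card ((({1, 6, 12, 64, 75, 76} : Multiset (ZMod 78)) + {e, -e}) - t) ∧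
            2 * mNormSum (((({1, 6, 12, 64, 75, 76} : Multiset (ZMod 78)) + {e, -e}) - t).map fun a ↦ (17 : ZMod 78) * a) = 78 * Multiset.card ((({1, 6, 12, 64, 75, 76} : Multiset (ZMod 78)) + {e, -e}) - t) ∧
            2 * mNormSum (((({1, 6, 12, 64, 75, 76} : Multiset (ZMod 78)) + {e, -e}) - t).map fun a ↦ (23 : ZMod 78) * a) = 78 * Multiset.card ((({1, 6, 12, 64, 75, 76} : Multiset (ZMod 78)) + {e, -e}) - t) ∧
            2 * mNormSum (((({1, 6, 12, 64, 75, 76} : Multiset (ZMod 78)) + {e, -e}) - t).map fun a ↦ (29 : ZMod 78) * a) = 78 * Multiset.card ((({1, 6, 12, 64, 75, 76} : Multiset (ZMod 78)) + {e, -e}) - t)) ∧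
          t ≠ 0 ∧ (({1, 6, 12, 64, 75, 76} : Multiset (ZMod 78)) + {e, -e}) - t ≠ 0 ∧ t ≠ ({1, 6, 12, 64, 75, 76} : Multiset (ZMod 78)) ∧ (({1, 6, 12, 64, 75, 76} : Multiset (ZMod 78)) + {e, -e}) - t ≠ ({1, 6, 12, 64, 75, 76} : Multiset (ZMod 78))) := by
  intro e
  obtain ⟨k, hk, rfl⟩ : ∃ k < 78, ((k : ℕ) : ZMod 78) = e :=
    ⟨e.val, e.val_lt, ZMod.natCast_zmod_val e⟩
  interval_cases k <;> decide +kernel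

/-- `s` is **not quasi-decomposable** (no `e ≠ 0` with `s + {e, −e} = ξ' + ξ''`, `ξ', ξ''` Hodge, both different from `s`).
[cite: daSilva2021HodgeFermat, Def. 2.4] [cite: Shioda1979PJA, §1 Definition (ii)] -/
theorem not_isQuasiDecomposable_fail_seventyEight : ¬ IsQuasiDecomposable ({1, 6, 12, 64, 75, 76} : Multiset (ZMod 78)) := by
  rintro ⟨e, -, t, u, ht0, hu0, ht, hu, hts, hus, heq⟩
  have htle : t ≤ ({1, 6, 12, 64, 75, 76} : Multiset (ZMod 78)) + {e, -e} := heq ▸ Multiset.le_add_right t u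
  have hu' : ({1, 6, 12, 64, 75, 76} : Multiset (ZMod 78)) + {e, -e} - t = u := by rw [heq, add_tsub_cancel_left]
  subst hu'
  exact fail_seventyEight_key e t (Multiset.mem_powerset.2 htle)
    ⟨hodgeConditions_seventyEight ht, hodgeConditions_seventyEight hu, ht0, hu0, hts, hus⟩

/-- **`(P⁴ₘ)` fails at `m = 78`** (Proc. Japan Acad. form, tree `ShiodaConditionUpTo 78 4`): the Hodge sextuple `s` is neither decomposable,
nor quasi-decomposable, nor semi-decomposable. Kernel certificate of the cell's P4-TABLE entry (two implementations + referee).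
[cite: Shioda1979PJA, §1 condition (Pⁿₘ)] -/
theorem not_shiodaConditionUpTo_seventyEight_four : ¬ ShiodaConditionUpTo 78 4 := fun h ↦ by
  rcases h _ isHodgeMultiset_fail_seventyEight (by decide) (by decide) with hd | hq | hs
  · exact not_isDecomposable_fail_seventyEight hd
  · exact not_isQuasiDecomposable_fail_seventyEight hq
  · exact not_isSemiDecomposable_fail_seventyEight hs

/-- Hence `(Pₘ)` (Proc. Japan Acad. form, all lengths) fails at `m = 78`. [cite: Shioda1979PJA, §1 conditions (Pⁿₘ), (Pₘ)] -/
theorem not_shiodaCondition_seventyEight : ¬ ShiodaCondition 78 := fun h ↦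
  not_shiodaConditionUpTo_seventyEight_four (shiodaCondition_iff_forall_upTo.1 h 4)

/-- **The Math. Ann. form of `(P⁴ₘ)` fails at `m = 78`** too: `s` is indecomposable and not quasi-decomposable.
[cite: Shioda1979HodgeFermat, §3 condition (Pⁿₘ), p. 180] -/
theorem not_conditionP_seventyEight_four : ¬ ConditionP 78 4 := fun h ↦
  not_isQuasiDecomposable_fail_seventyEight
    (h _ isHodgeMultiset_fail_seventyEight (by decide) (by decide) not_isDecomposable_fail_seventyEight)

/-- Hence the Math. Ann. condition `(Pₘ)` fails at `m = 78`. [cite: Shioda1979HodgeFermat, §3 condition (Pₘ), p. 180] -/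
theorem not_conditionPAll_seventyEight : ¬ ConditionPAll 78 := fun h ↦
  not_conditionP_seventyEight_four (conditionPAll_iff_forall.1 h 4)

/-- **Shioda's question (Math. Ann. 245, p. 184), the fourfold instance at `m = 78`**: "we do not know any value of `m` which satisfies
`(Qₘ)` but not `(Pₘ)`" — at `m = 78` the length-`3` condition `(Q⁴ₘ)` HOLDS while `(P⁴ₘ)` FAILS (in both printed forms). Whether `(Qₘ)` holds
at ALL lengths for `m = 78` is not decided here. Computer-assisted (cell `pub-hfermat`, two implementations), certified by the kernel.
[cite: Shioda1979HodgeFermat, §4, p. 184 (the question)] -/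
theorem conditionQ_not_conditionP_seventyEight : ConditionQ 78 4 ∧ ¬ ConditionP 78 4 :=
  ⟨conditionQ_seventyEight_four, not_conditionP_seventyEight_four⟩

end Summit.HodgeConjecture.FermatCycles.ConditionQFourfold
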